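import Summits.BirchSwinnertonDyer.BirchSwinnertonDyer.Theorems.ManinLocalTwoThreeVertexTwoStability
import Summits.BirchSwinnertonDyer.BirchSwinnertonDyer.Theorems.ManinLocalTwoThreeExtensionLemmas
import Summits.BirchSwinnertonDyer.Rank1Residual.ManinAdditive.RelativeIharaShiftVanishingEdges
import HarnessLib

/-!
# The `t = 2` vertex step, part 2: `[Γ₀(L′) : Γ₀(2L′)] = 3` and the extension — a `2`-shift-invariant homomorphism on
# `Γ₀(2L′)` is `2`-old (E-es-41m at `t = 2`, MEMO-es §25.3 (V-a))

Summit `BirchSwinnertonDyer`, route `ManinLocalTwoThree` (cell bsd-f2-manin), crux C2 `ManinOddAtFour` (stmt-BirchSwinnertonDyer-22967),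
line `kato_shift_two` v6, stub 3 (`C₃`-image residual), VERTEX STEP at `t = 2` (lead assignment, cell INBOX 2026-08-28T04:46:01Z).
For `L′` odd, a field `K` with `3 ≠ 0`, and a degree-`0` cocycle `u` on `Γ₀(2L′)` with `π₂^* u = π₁^* u` on `Γ₀(4L′)`:

* `index_gamma0_mul_two`: `[Γ₀(L′) : Γ₀(2L′)] = 3` (explicit bijection `Γ₀(L′)/Γ₀(2L′) ≃ P¹(𝔽₂)` by the first column mod `2`);
* `exists_cocycle_eq_degeneracyPullback_one_of_shiftInvariant_two`: `u = π₁^* u₀` for some degree-`0` cocycle `u₀` on `Γ₀(L′)` —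
  EXT-ODD (`exists_extension_of_stable_of_index_invertible`, p605692) applied to `Γ₀(2L′) ≤ Γ₀(L′)` with the stability of part 1
  (`apply_inv_conj_eq_of_shiftInvariant`, p606258); no `N₃`, no `extTwo` is needed at the vertex;
* `exists_cocycle_diamond_of_shiftInvariant_two` and **`shiftInvariantIsOldUpToDiamondMin_two`**: the body of es's typed row
  `EsG12.ShiftInvariantIsOldUpToDiamondMin p 2` (HOME/es/Sketch-es-g12.lean), verbatim with `t := 2` and the diamond character
  `ψ := 0`, for every prime `p ≠ 3` — UNCONDITIONAL (no F-es-26′/27 fact at `t = 2`).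

No new definitions; nothing about BSD or Manin's conjecture is proved here.

References: K. S. Brown, *Cohomology of Groups*, III.9.5 (ii), III.10.3 [cite: Brown1982, III.10.3]; J.-P. Serre, *Trees*, II.1.4;
cell memo HOME/MEMO-es.md §25.3 (V-a), §25.11; INBOX 2026-08-28T04:30:03Z (es USE MAP), 04:46:01Z (lead).
-/

set_option autoImplicit false
set_option linter.dupNamespace false

open scoped MatrixGroups

open CongruenceSubgroup Matrix.SpecialLinearGroup Literature.NumberTheory.EllipticCurves.ModularForms
  Literature.NumberTheory.EllipticCurves.ModularForms.HidaCohomology Subgroup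
  Summit.BirchSwinnertonDyer.Rank1Residual.ManinAdditive

namespace Summit.BirchSwinnertonDyer.BirchSwinnertonDyer.Theorems.ManinLocalTwoThree

/-! ### The index `[Γ₀(L′) : Γ₀(2L′)] = 3` for odd `L′` -/

section Index

variable {L' : ℕ}

/-- **`[Γ₀(L′) : Γ₀(2L′)] = 3` for odd `L′`**: the first column mod `2` identifies `Γ₀(L′)/Γ₀(2L′)` with the three non-zero vectors
of `𝔽₂²` (`= P¹(𝔽₂)`), hit by `1`, `(1 0; L′ 1)` and `(1 1; 0 1)(1 0; L′ 1)`. [cite: Shimura1971, §1.6 Prop. 1.43] -/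
theorem index_gamma0_mul_two [NeZero L'] (hL' : ¬ 2 ∣ L') : ((Gamma0 (L' * 2)).subgroupOf (Gamma0 L')).index = 3 := by
  classical
  have two : ∀ x : ZMod 2, x = 0 ∨ x = 1 := by decide
  have form : ∀ x y z w : ZMod 2, (x, y) ≠ (0, 0) → (z, w) ≠ (0, 0) → (x * w - y * z = 0 ↔ (x, y) = (z, w)) := by
    decide
  have nz : ∀ p q r s : ZMod 2, p * s - q * r = 1 → (p, r) ≠ (0, 0) := by decide
  set H := (Gamma0 (L' * 2)).subgroupOf (Gamma0 L') with hH
  -- parities of the first column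
  let φ : Gamma0 L' → ZMod 2 × ZMod 2 := fun g ↦
    ((((g : SL(2, ℤ)) 0 0 : ℤ) : ZMod 2), (((g : SL(2, ℤ)) 1 0 : ℤ) : ZMod 2))
  have hφne : ∀ g : Gamma0 L', φ g ≠ (0, 0) := fun g ↦
    nz _ (((g : SL(2, ℤ)) 0 1 : ℤ) : ZMod 2) _ (((g : SL(2, ℤ)) 1 1 : ℤ) : ZMod 2) (det_cast_zmod_two (g : SL(2, ℤ)))
  have hmem : ∀ a b : Gamma0 L', a⁻¹ * b ∈ H ↔ φ a = φ b := by
    intro a b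
    rw [mem_subgroupOf, Subgroup.coe_mul, Subgroup.coe_inv,
      mem_Gamma0_mul_two_iff hL' (Subgroup.mul_mem _ (Subgroup.inv_mem _ a.2) b.2)]
    have e : ((a : SL(2, ℤ))⁻¹ * (b : SL(2, ℤ)) : SL(2, ℤ)) 1 0 =
        (a : SL(2, ℤ)) 0 0 * (b : SL(2, ℤ)) 1 0 - (a : SL(2, ℤ)) 1 0 * (b : SL(2, ℤ)) 0 0 := by
      simp [Matrix.SpecialLinearGroup.coe_mul, Matrix.SpecialLinearGroup.coe_inv, Matrix.adjugate_fin_two,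
        Matrix.mul_apply, Fin.sum_univ_two]
      ring
    rw [e]
    push_cast
    exact form _ _ _ _ (hφne a) (hφne b)
  rw [Subgroup.index_eq_card]
  let f : (↥(Gamma0 L') ⧸ H) → {v : ZMod 2 × ZMod 2 // v ≠ (0, 0)} := fun x ↦
    Quotient.liftOn' x (fun g ↦ ⟨φ g, hφne g⟩)
      (fun a b hab ↦ Subtype.ext ((hmem a b).mp (QuotientGroup.leftRel_apply.mp hab)))
  have hfmk : ∀ g : Gamma0 L', f (QuotientGroup.mk g) = ⟨φ g, hφne g⟩ := fun g ↦ rfl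
  -- the three representatives `1`, `σ = (1 0; L′ 1)`, `τσ`
  have hdetσ : Matrix.det !![(1 : ℤ), 0; (L' : ℤ), 1] = 1 := by rw [Matrix.det_fin_two_of]; ring
  obtain ⟨σ, hσdef⟩ : ∃ σ : SL(2, ℤ), (σ : Matrix (Fin 2) (Fin 2) ℤ) = !![(1 : ℤ), 0; (L' : ℤ), 1] :=
    ⟨⟨_, hdetσ⟩, rfl⟩
  have hσ00 : σ 0 0 = 1 := by
    show (σ : Matrix (Fin 2) (Fin 2) ℤ) 0 0 = 1
    rw [hσdef]; rfl
  have hσ10 : σ 1 0 = (L' : ℤ) := by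
    show (σ : Matrix (Fin 2) (Fin 2) ℤ) 1 0 = (L' : ℤ)
    rw [hσdef]; rfl
  have hσ : σ ∈ Gamma0 L' := by
    rw [Gamma0_mem]
    show (((σ 1 0 : ℤ) : ZMod L')) = 0
    rw [hσ10, Int.cast_natCast, ZMod.natCast_self]
  have hT : ModularGroup.T ∈ Gamma0 L' := T_mem_Gamma0 L'
  have hL'2 : ((L' : ℕ) : ZMod 2) = 1 := by
    rw [ZMod.natCast_eq_one_iff_odd]
    exact Nat.odd_iff.mpr (Nat.two_dvd_ne_zero.mp hL')
  obtain ⟨-, -, eT3, -, eT5⟩ := mul_T_apply σ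
  have hf : Function.Bijective f := by
    constructor
    · intro x y hxy
      induction x using QuotientGroup.induction_on with | H a => ?_
      induction y using QuotientGroup.induction_on with | H b => ?_
      rw [hfmk, hfmk] at hxy
      exact QuotientGroup.eq.mpr ((hmem a b).mpr (congrArg Subtype.val hxy))
    · rintro ⟨⟨x, y⟩, hv⟩
      rcases two x with rfl | rfl <;> rcases two y with rfl | rfl
      · exact absurd rfl hv
      · -- `(0, 1)`: `τσ`
        refine ⟨QuotientGroup.mk ⟨ModularGroup.T * σ, Subgroup.mul_mem _ hT hσ⟩, Subtype.ext ?_⟩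
        rw [hfmk]
        show ((((ModularGroup.T * σ) 0 0 : ℤ) : ZMod 2), (((ModularGroup.T * σ) 1 0 : ℤ) : ZMod 2)) =
          ((0 : ZMod 2), (1 : ZMod 2))
        rw [eT3, eT5, hσ00, hσ10]
        push_cast
        simp only [hL'2]
        decide
      · -- `(1, 0)`: `1`
        refine ⟨QuotientGroup.mk 1, Subtype.ext ?_⟩
        rw [hfmk]
        show ((((1 : SL(2, ℤ)) 0 0 : ℤ) : ZMod 2), (((1 : SL(2, ℤ)) 1 0 : ℤ) : ZMod 2)) = ((1 : ZMod 2), (0 : ZMod 2))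
        simp
      · -- `(1, 1)`: `σ`
        refine ⟨QuotientGroup.mk ⟨σ, hσ⟩, Subtype.ext ?_⟩
        rw [hfmk]
        show (((σ 0 0 : ℤ) : ZMod 2), ((σ 1 0 : ℤ) : ZMod 2)) = ((1 : ZMod 2), (1 : ZMod 2))
        rw [hσ00, hσ10]
        push_cast
        simp only [hL'2]
  rw [Nat.card_eq_of_bijective f hf, Nat.card_eq_fintype_card]
  decide

end Index

/-! ### The extension across `Γ₀(2L′) ≤ Γ₀(L′)` -/

section Extension

variable {L' : ℕ} [NeZero L'] (hL' : ¬ 2 ∣ L') {K : Type*} [Field K] (h3 : (3 : K) ≠ 0)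
include hL' h3

/-- **A `2`-shift-invariant homomorphism on `Γ₀(2L′)` is `2`-old** (`L′` odd, `3 ≠ 0` in `K`): if `π₂^* u = π₁^* u` on `Γ₀(4L′)`
then `u = π₁^* u₀` for a degree-`0` cocycle `u₀` on `Γ₀(L′)` — EXT-ODD for `Γ₀(2L′) ≤ Γ₀(L′)` (index `3`) with the stability
`apply_inv_conj_eq_of_shiftInvariant`. [cite: Brown1982, III.10.3] -/
theorem exists_cocycle_eq_degeneracyPullback_one_of_shiftInvariant_two (u : cocycles 0 (L' * 2) K)
    (hshift : degeneracyPullback 0 (L' * 2) (L' * 2 * 2) 2 K dvd_rfl (u : Gamma0 (L' * 2) → Fin 1 → K) =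
      degeneracyPullback 0 (L' * 2) (L' * 2 * 2) 1 K (by simp) (u : Gamma0 (L' * 2) → Fin 1 → K)) :
    ∃ u₀ : cocycles 0 L' K, (u : Gamma0 (L' * 2) → Fin 1 → K) =
      degeneracyPullback 0 L' (L' * 2) 1 K (by simp) (u₀ : Gamma0 L' → Fin 1 → K) := by
  classical
  set H := (Gamma0 (L' * 2)).subgroupOf (Gamma0 L') with hH
  haveI : H.FiniteIndex := ⟨by rw [index_gamma0_mul_two hL']; decide⟩
  have memH : ∀ {x : Gamma0 L'}, x ∈ H ↔ (x : SL(2, ℤ)) ∈ Gamma0 (L' * 2) := mem_subgroupOf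
  -- the character `ψ = u` on `H`
  let ψ : H →* Multiplicative K := MonoidHom.mk'
    (fun x ↦ Multiplicative.ofAdd ((u : Gamma0 (L' * 2) → Fin 1 → K) ⟨((x : Gamma0 L') : SL(2, ℤ)), memH.mp x.2⟩ 0))
    (by
      intro a b
      rw [← ofAdd_add]
      congr 1
      have e : (⟨(((a * b : H) : Gamma0 L') : SL(2, ℤ)), memH.mp (a * b).2⟩ : Gamma0 (L' * 2)) =
          ⟨((a : Gamma0 L') : SL(2, ℤ)), memH.mp a.2⟩ * ⟨((b : Gamma0 L') : SL(2, ℤ)), memH.mp b.2⟩ := rfl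
      rw [e, cocycle_zero_mul u.2, Pi.add_apply])
  have hψ : ∀ x : H, ψ x =
      Multiplicative.ofAdd ((u : Gamma0 (L' * 2) → Fin 1 → K) ⟨((x : Gamma0 L') : SL(2, ℤ)), memH.mp x.2⟩ 0) :=
    fun x ↦ rfl
  have key : ∀ (x : H) (g₀ : Gamma0 L') (hk : g₀⁻¹ * (x : Gamma0 L') * g₀ ∈ H),
      ψ ⟨g₀⁻¹ * (x : Gamma0 L') * g₀, hk⟩ = ψ x := by
    intro x g₀ hk
    rw [hψ, hψ]
    congr 1
    have hk' : (g₀ : SL(2, ℤ))⁻¹ * ((x : Gamma0 L') : SL(2, ℤ)) * (g₀ : SL(2, ℤ)) ∈ Gamma0 (L' * 2) := memH.mp hk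
    have e : (⟨(((⟨g₀⁻¹ * (x : Gamma0 L') * g₀, hk⟩ : H) : Gamma0 L') : SL(2, ℤ)), memH.mp hk⟩ : Gamma0 (L' * 2)) =
        ⟨(g₀ : SL(2, ℤ))⁻¹ * ((x : Gamma0 L') : SL(2, ℤ)) * (g₀ : SL(2, ℤ)), hk'⟩ := rfl
    rw [e]
    exact congrFun
      (apply_inv_conj_eq_of_shiftInvariant u.2 hshift hL' g₀.2 ⟨((x : Gamma0 L') : SL(2, ℤ)), memH.mp x.2⟩ hk') 0
  have hidx : (H.index : K) ≠ 0 := by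
    rw [index_gamma0_mul_two hL']
    exact_mod_cast h3
  obtain ⟨Ψ, hΨ⟩ := exists_extension_of_stable_of_index_invertible ψ key hidx
  refine ⟨⟨fun γ _ ↦ Multiplicative.toAdd (Ψ γ), ?_⟩, ?_⟩
  · rw [mem_cocycles_iff]
    intro γ δ
    funext i
    rw [act_zero_eq_id, LinearMap.id_apply, Pi.add_apply, map_mul, toAdd_mul, add_comm]
  · funext γ i
    rw [degeneracyPullback_zero_apply]
    set γ₀ := Gamma0.degeneracyConj L' (L' * 2) 1 (by simp) γ with hγ₀
    have hcoe : (γ₀ : SL(2, ℤ)) = (γ : SL(2, ℤ)) := Gamma0.coe_degeneracyConj_one _ γ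
    have hmem0 : γ₀ ∈ H := memH.mpr (hcoe ▸ γ.2)
    show (u : Gamma0 (L' * 2) → Fin 1 → K) γ i = Multiplicative.toAdd (Ψ γ₀)
    rw [hΨ ⟨γ₀, hmem0⟩, hψ, toAdd_ofAdd]
    have e : (⟨(((⟨γ₀, hmem0⟩ : H) : Gamma0 L') : SL(2, ℤ)), memH.mp hmem0⟩ : Gamma0 (L' * 2)) = γ := Subtype.ext hcoe
    rw [e, show i = 0 from Subsingleton.elim (α := Fin 1) i 0]

/-- The same in the currency of es's E-es-41m (diamond character `ψ := 0`). [cite: Brown1982, III.10.3] -/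
theorem exists_cocycle_diamond_of_shiftInvariant_two (u : cocycles 0 (L' * 2) K)
    (hshift : degeneracyPullback 0 (L' * 2) (L' * 2 * 2) 2 K dvd_rfl (u : Gamma0 (L' * 2) → Fin 1 → K) =
      degeneracyPullback 0 (L' * 2) (L' * 2 * 2) 1 K (by simp) (u : Gamma0 (L' * 2) → Fin 1 → K)) :
    ∃ (u₀ : cocycles 0 L' K) (ψ : ZMod 2 → K),
      (u : Gamma0 (L' * 2) → Fin 1 → K) =
        degeneracyPullback 0 L' (L' * 2) 1 K (by simp) (u₀ : Gamma0 L' → Fin 1 → K) + diamondFun (L' * 2) 2 K ψ := by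
  obtain ⟨u₀, hu₀⟩ := exists_cocycle_eq_degeneracyPullback_one_of_shiftInvariant_two hL' h3 u hshift
  refine ⟨u₀, 0, ?_⟩
  rw [hu₀]
  funext γ i
  rw [Pi.add_apply, Pi.add_apply, diamondFun_apply, Pi.zero_apply, add_zero]

omit hL' h3

/-- **E-es-41m at `t = 2`** — the body of es's `EsG12.ShiftInvariantIsOldUpToDiamondMin p 2` (HOME/es/Sketch-es-g12.lean), for every
prime `p ≠ 3`: a `2`-shift-invariant homomorphism on `Γ₀(2L′)` (`L′` odd) over a field of characteristic `p` is old from `Γ₀(L′)`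
up to a diamond character mod `2`. UNCONDITIONAL. [cite: Brown1982, III.10.3] -/
theorem shiftInvariantIsOldUpToDiamondMin_two {p : ℕ} (hp3 : p ≠ 3) :
    p.Prime → (2 : ℕ).Prime →
    ∀ (K : Type) [Field K] [CharP K p] (L' : ℕ) [NeZero L'] [NeZero (2 : ℕ)], ¬ 2 ∣ L' →
    ∀ (u : cocycles 0 (L' * 2) K),
      degeneracyPullback 0 (L' * 2) (L' * 2 * 2) 2 K dvd_rfl (u : Gamma0 (L' * 2) → Fin 1 → K) =
        degeneracyPullback 0 (L' * 2) (L' * 2 * 2) 1 K (by simp) (u : Gamma0 (L' * 2) → Fin 1 → K) →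
      ∃ (u₀ : cocycles 0 L' K) (ψ : ZMod 2 → K),
        (u : Gamma0 (L' * 2) → Fin 1 → K) =
          degeneracyPullback 0 L' (L' * 2) 1 K (by simp) (u₀ : Gamma0 L' → Fin 1 → K) + diamondFun (L' * 2) 2 K ψ := by
  intro hp _ K _ _ L' _ _ hL' u hshift
  have h3 : (3 : K) ≠ 0 := by
    intro h
    have h' : ((3 : ℕ) : K) = 0 := by exact_mod_cast h
    rw [CharP.cast_eq_zero_iff K p] at h'
    exact hp3 ((Nat.prime_dvd_prime_iff_eq hp Nat.prime_three).mp h')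
  exact exists_cocycle_diamond_of_shiftInvariant_two hL' h3 u hshift

end Extension

end Summit.BirchSwinnertonDyer.BirchSwinnertonDyer.Theorems.ManinLocalTwoThree
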